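import Summits.Schanuel.Schanuel.Theorems.RootDecomp1KDigitPincer02

/-!
# RootDecomp1KDigitPincer — lens 1, generation 66, NODE 26 «THE SECOND-ORDER 2-ADIC DIGIT PINCER ON THE K-LINE — the standing witness X6 = x³ + Y·x + Y⁷ + 3 decided: EMPTY AT EVERY LEVEL» (×0-as-record: node 9's toolkit programme §8 (a); the odd-middle pencil XP b c = x³ + b·x·Y + Y⁷ + c, b odd, EMPTY at every level N ≠ 1 with 2^N ≥ 2|b| + 9 + |c| and at N = 0, 2 ≤ N ≤ 6; X6P / X5P / X3P at every level; elementary: p_N ≡ 1 mod 2^(N!−(N−1)!) against the far-edge congruence and the real window; CLAIM L3006, PRICE L3009, ERRATUM E4, RULE K-R57, VERDICT L3015) — continuation (RootDecomp1KDigitPincer03): §7 X6P / X5P BY NAME (no_level, levelSet = ∅, LevelFinite, BddLevelEmpty, ThinFibreAt ∀ m₀) + §T territory refusals and X6P_territory; the X3P twins dropped (dedup with node 25's record names)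

(lens-1 g66 NODE 26 «THE SECOND-ORDER 2-ADIC DIGIT PINCER ON THE K-LINE — the standing witness X6 = x³ + Y·x + Y⁷ + 3 decided: EMPTY AT EVERY LEVEL» L3013: HOME kernel K = HOME/decomp-schanuel-lens-1/g66/lean/DigitPincer.lean sha256 70263161…, 778 l, 67 decls, ONE namespace `Summit.Schanuel.Schanuel.Theorems.RootDecomp1KDigitPincer`, imports the tree port …RootDecomp1KW4Dossier01 ONLY; no private / instance / set_option / notation / sorry / decide; lens farm rc 0 · 0 errors · 0 sorries · 67 dupNamespace, axioms standard, Probe rc 0; CLAIM L3006 (ASK-FIRST under K-R56 (iii)(d)); crit g12 PRICE L3009: ×0-AS-RECORD (the pincer = node 9's TOOLKIT programme §8 (a) of RootDecomp1KDegreeLadder08 l.34–55), ERRATUM E4 («the dominant-far standing witnesses were reachable by the toolkit all along»: X6's certificate L3000 REVOKED, X5 MOOT, X3 struck (E3) ∧ decided), RULE K-R57 PRE-ANNOUNCED, CHECKLIST K-g66; writer g34 NOTE 13 L3008 (pre-check: precision (α) level N = 1, exact enumeration at levels 0–6); crit VERDICT L3015 (2026-09-02T01:34Z): CLEARED FOR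 THE RECORD ×0-AS-RECORD, CHECKLIST K-g66 (1)–(8) MET, RULE K-R57 FIXED (clauses (i)–(iv) of PRICE L3009 (4) verbatim + GLOSS K-R57), tally UNCHANGED lens-1 ×21 + THEOREM ×23, PORT GO → census-1 (source = K verbatim + provenance block; `--supports stmt-Schanuel-33364`, the item stays OPEN; RULE K-R57 (iv): UNCONDITIONAL PART ∪= these names). Port by census-1 gen 24 as `RootDecomp1KDigitPincer01–03` (×0 record port, no credit anywhere; files ≤ 400 lines): 01 = header + §0 the pencil `xc` / `XP b c` / `X6P` with `XP_one_two_eq_X5P` / `XP_one_zero_eq_X3P` (node 25's terms NOT re-declared) + §1 parity bookkeeping + §2 (P1) clearing denominators + §3 (P2)–(P3) den = 2^e and the tie 7e = 3M + §4 (P4)–(P5) the digit congruence 2^K ∣ a + 1 and a ≠ −1 + §5 (P6) the archimedean window; 02 = §6 the chain at a level N named step by step (`den_eq_two_pow_of_level`, `seven_e_eq_three_M`, `two_pow_dvd_num_add_one`, `num_ne_neg_one`, `abs_num_window`, …, `no_level_XP_of_pow_le`, `no_level_XP_lt_seven`, `levelFinite_XP`, `bddLevelEmpty_XP`, `thinFibreAt_XP`);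 03 = §7 BY NAME `no_level_one`, `no_level_X6P`, `levelSet_X6P_eq_empty`, `levelFinite_X6P`, `bddLevelEmpty_X6P`, `thinFibreAt_X6P`, `thinFibreAt_two_X6P`, the same five for the tree's `X5P` + §T territory `not_decidedAt_two_X6P`, `not_localAt_X6P`, `not_fermatTri_X6P`, `not_domSuper_X6P`, `not_domHyper_X6P`, `X6P_territory`. DROPPED AS A BLOCK (VERDICT L3015 option «the X3P twins may be kept or dropped as a block; say which»): the three twins `no_level_X3P_pincer` / `levelFinite_X3P_pincer` / `thinFibreAt_X3P_pincer` (K l.650–668) — their STATEMENTS coincide with node 25's landed `RootDecomp1KTrinomialDescent.no_level_X3P` / `levelFinite_X3P` / `thinFibreAt_X3P` and the gate's dedup.landed lint bounces such restatements; node 25's names stay the record for X3. Everything else = K VERBATIM (every declaration documented by the lens; statements, names and proofs unchanged; K's module docstring kept in part 01 below this provenance block).)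
-/

noncomputable section

namespace Summit.Schanuel.Schanuel.Theorems.RootDecomp1KDigitPincer

open Polynomial Finset
open LiouvilleNumber
open scoped Nat
open Summit.Schanuel.Schanuel.Theorems.RootDecomp1KDegreeLadder
open Summit.Schanuel.Schanuel.Theorems.RootDecomp1KXTop
open Summit.Schanuel.Schanuel.Theorems.RootDecomp1KXAll
open Summit.Schanuel.Schanuel.Theorems.RootDecomp1KLevelFinite
open Summit.Schanuel.Schanuel.Theorems.RootDecomp1KHeightGrading (BddLevelEmpty bddLevelEmpty_iff_levelFinite)
open Summit.Schanuel.Schanuel.Theorems.RootDecomp1KOddEmpty (levelFinite_of_no_level)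
open Summit.Schanuel.Schanuel.Theorems.RootDecomp1KTwoBaseCell (psNumer partialSum_eq_psNumer_div coprime_psNumer
  partialSum_lt_two partialSum_pos')
open Summit.Schanuel.Schanuel.Theorems.RootDecomp1KTrinomialDescent (two_adic_tie two_adic_strict X5P x5C X3P x3C
  FermatTri not_fermatTri_of_two_coeffs)
open Summit.Schanuel.Schanuel.Theorems.RootDecomp1KSuperellipticSiegel (DomSuper partialSum_two_one)
open Summit.Schanuel.Schanuel.Theorems.RootDecomp1KHyperellipticSiegel (DomHyper)
open Summit.Schanuel.Schanuel.Theorems.RootDecomp1KXLinear (xLinP bev_xLinP XLinearLt)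
open Summit.Schanuel.Schanuel.Theorems.RootDecomp1KLocalExponent (LocalAt SlopeCond RootCond)

/-! ## §7  THE STANDING WITNESS `X6` BY NAME (and the nominee `X5`, and `X3` re-decided) -/

/-- level `1` (`s_1 = 1`) of `XP 1 c` for `c ∈ {0, 2, 3}`: an integer root test (`a ∣ 1 + c`, `d = 1`). -/
theorem no_level_one {c : ℤ} (hc : c = 0 ∨ c = 2 ∨ c = 3) (r : ℚ) : bev (XP 1 c) (partialSum 2 1) r ≠ 0 := by
  intro h0
  have hs1 : partialSum 2 1 = ((1 : ℤ) : ℝ) / 2 ^ 0 := by rw [partialSum_two_one]; norm_num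
  rw [hs1] at h0
  have hE := int_eq_of_root h0
  simp only [mul_zero, pow_zero, mul_one, one_pow, one_mul] at hE
  -- hE : d⁷ + a·d⁶ + a⁷ + c·d⁷ = 0 with d = den r ≥ 1, a = num r coprime to d
  set a : ℤ := r.num with ha
  set d : ℕ := r.den with hd
  have hd1 : d = 1 := by
    have hdvd : (d : ℤ) ∣ a ^ 7 := ⟨-((d : ℤ) ^ 6 + a * (d : ℤ) ^ 5 + c * (d : ℤ) ^ 6), by linear_combination hE⟩
    have hcop : IsCoprime (d : ℤ) (a ^ 7) := by
      refine IsCoprime.pow_right ?_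
      rw [Int.isCoprime_iff_gcd_eq_one, Int.gcd]
      simpa [hd, ha, Nat.coprime_comm] using r.reduced
    have h1 : (d : ℤ) ∣ 1 := hcop.dvd_of_dvd_mul_left (by simpa using hdvd)
    have := Int.eq_one_of_dvd_one (by positivity) h1
    exact_mod_cast this
  have hdZ : (d : ℤ) = 1 := by exact_mod_cast hd1
  rw [hdZ] at hE
  simp only [one_pow, mul_one] at hE
  -- a⁷ + a + 1 + c = 0 : a ∣ 1 + c, so |a| ≤ 1 + c ≤ 4, and no such a works
  have key : a * (a ^ 6 + 1) = -(1 + c) := by linear_combination hE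
  have hdv : a ∣ 1 + c := ⟨-(a ^ 6 + 1), by linear_combination hE⟩
  rcases hc with rfl | rfl | rfl
  all_goals
    have h1 := Int.le_of_dvd (by norm_num) hdv
    have h2 := Int.le_of_dvd (by norm_num) (neg_dvd.mpr hdv)
    have h3 : -5 ≤ a := by omega
    have h4 : a ≤ 5 := by omega
    interval_cases a <;> norm_num at hE

/-- **`X6` HAS NO LEVEL POINT AT ANY LEVEL** — the certified standing witness decided, hypothesis-free. -/
theorem no_level_X6P : ∀ (N : ℕ) (r : ℚ), bev X6P (partialSum 2 N) r ≠ 0 := by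
  intro N r
  rw [X6P_eq]
  rcases Nat.lt_or_ge N 7 with hlt | hge
  · by_cases h1 : N = 1
    · subst h1; exact no_level_one (by norm_num) r
    · exact no_level_XP_lt_seven odd_one 3 h1 hlt r
  · refine no_level_XP_of_pow_le odd_one ?_ r
    calc 2 * (1 : ℤ).natAbs + 9 + (3 : ℤ).natAbs = 14 := by norm_num
      _ ≤ 2 ^ 4 := by norm_num
      _ ≤ 2 ^ N := Nat.pow_le_pow_right (by norm_num) (by omega)

/-- every level set of `X6` is EMPTY. -/
theorem levelSet_X6P_eq_empty (C : ℝ) : LevelSet X6P C = ∅ :=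
  Set.eq_empty_iff_forall_notMem.mpr fun N ⟨r, _, hP, _⟩ => no_level_X6P N r hP

/-- `LevelFinite X6P`. -/
theorem levelFinite_X6P : LevelFinite X6P := levelFinite_of_no_level no_level_X6P

/-- `BddLevelEmpty X6P`. -/
theorem bddLevelEmpty_X6P : BddLevelEmpty X6P := (bddLevelEmpty_iff_levelFinite _).mpr levelFinite_X6P

/-- **`ThinFibreAt m₀ X6P` for EVERY `m₀`** — in particular at the open quality `m₀ = 2` of the record. -/
theorem thinFibreAt_X6P (m₀ : ℕ) : ThinFibreAt m₀ X6P := thinFibreAt_of_levelFinite levelFinite_X6P m₀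

/-- `ThinFibreAt 2 X6P`. -/
theorem thinFibreAt_two_X6P : ThinFibreAt 2 X6P := thinFibreAt_X6P 2

/-- **the nominee `X5 = x³ + Y·x + Y⁷ + 2` has no level point at any level** (tree term `X5P`, node 25). -/
theorem no_level_X5P : ∀ (N : ℕ) (r : ℚ), bev X5P (partialSum 2 N) r ≠ 0 := by
  intro N r
  rw [X5P_eq]
  rcases Nat.lt_or_ge N 7 with hlt | hge
  · by_cases h1 : N = 1
    · subst h1; exact no_level_one (by norm_num) r
    · exact no_level_XP_lt_seven odd_one 2 h1 hlt r
  · refine no_level_XP_of_pow_le odd_one ?_ r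
    calc 2 * (1 : ℤ).natAbs + 9 + (2 : ℤ).natAbs = 13 := by norm_num
      _ ≤ 2 ^ 4 := by norm_num
      _ ≤ 2 ^ N := Nat.pow_le_pow_right (by norm_num) (by omega)

/-- every level set of `X5` is EMPTY. -/
theorem levelSet_X5P_eq_empty (C : ℝ) : LevelSet X5P C = ∅ :=
  Set.eq_empty_iff_forall_notMem.mpr fun N ⟨r, _, hP, _⟩ => no_level_X5P N r hP

/-- `LevelFinite X5P`. -/
theorem levelFinite_X5P : LevelFinite X5P := levelFinite_of_no_level no_level_X5P

/-- `ThinFibreAt m₀ X5P` for every `m₀`. -/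
theorem thinFibreAt_X5P (m₀ : ℕ) : ThinFibreAt m₀ X5P := thinFibreAt_of_levelFinite levelFinite_X5P m₀

/-- `BddLevelEmpty X5P`. -/
theorem bddLevelEmpty_X5P : BddLevelEmpty X5P := (bddLevelEmpty_iff_levelFinite _).mpr levelFinite_X5P

/-! ## §T  TERRITORY: where `X6` sits among the classes of record (the refusals that made E4 possible, typed beside
the theorem that decides the class) -/

/-- `xc 1 3 3 = 1 ≠ 0`. -/
theorem xc_three (b c : ℤ) : xc b c 3 = 1 := by simp [xc]

/-- `xc b c 0 = Y⁷ + c`. -/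
theorem xc_zero (b c : ℤ) : xc b c 0 = X ^ 7 + C c := by simp [xc]

/-- `xdeg X6P = 3`. -/
theorem xdeg_X6P : xdeg X6P = 3 := xdeg_xPolyP 3 (xc 1 3) (by rw [xc_three]; exact one_ne_zero)

/-- `xCoeff X6P i = xc 1 3 i` for `i ≤ 3`, else `0`. -/
theorem xCoeff_X6P (i : ℕ) : xCoeff X6P i = if i ≤ 3 then xc 1 3 i else 0 := xCoeff_xPolyP 3 _ i

/-- `xCoeff X6P 1 = Y ≠ 0`: NON-LACUNARY (the middle term that takes `X6` out of nodes 22–24). -/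
theorem xCoeff_X6P_one : xCoeff X6P 1 = X := by
  rw [xCoeff_X6P, if_pos (by norm_num)]; simp [xc]

/-- `7 ≤ natDegree X6P` (the `Y`-degree: `[Y⁷]` of `xCoeff 0` is `1`). -/
theorem seven_le_natDegree_X6P : 7 ≤ X6P.natDegree := by
  refine le_natDegree_of_ne_zero fun h => ?_
  have h1 := congrArg (fun q : ℤ[X] => q.coeff 0) h
  simp only [X6P, XP, coeff_coeff_xPolyP, coeff_zero] at h1
  rw [if_pos (by simp), xc_zero] at h1
  simp [coeff_X_pow] at h1

/-- in a presentation `X6P = xPolyP k c` with `c k ≠ 0`: `k = 3`, `c 0 = Y⁷ + 3`, `c 3 = 1`. -/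
theorem presentation_X6P {k : ℕ} {c : ℕ → ℤ[X]} (hck : c k ≠ 0) (h : X6P = xPolyP k c) :
    k = 3 ∧ c 0 = X ^ 7 + C 3 ∧ c 3 = 1 := by
  have hk : k = 3 := by have := xdeg_xPolyP k c hck; rw [← h, xdeg_X6P] at this; exact this.symm
  subst hk
  have h0 := xCoeff_xPolyP 3 c 0
  have h3 := xCoeff_xPolyP 3 c 3
  rw [← h, xCoeff_X6P, if_pos (by norm_num)] at h0 h3
  rw [if_pos (by norm_num), xc_zero] at h0
  rw [if_pos (by norm_num), xc_three] at h3
  exact ⟨rfl, h0.symm, h3.symm⟩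

/-- `X6` has NO x-linear presentation (second `x`-difference of `X6(x, 0) = x³ + 3` is `6 ≠ 0`). -/
theorem X6P_ne_xLinP (A₁ B₁ : ℤ[X]) : X6P ≠ xLinP A₁ B₁ := by
  intro hP
  have h := fun x : ℝ => congrArg (fun Q => bev Q x 0) hP
  have h0 := h 0
  have h1 := h 1
  have h2 := h 2
  simp only [bev_X6P, bev_xLinP] at h0 h1 h2
  have : (6 : ℝ) = 0 := by linear_combination h0 - 2 * h1 + h2
  norm_num at this

/-- `¬ XLinearLt X6P`. -/
theorem not_xLinearLt_X6P : ¬ XLinearLt X6P := fun ⟨A₁, B₁, _, _, hP⟩ => X6P_ne_xLinP A₁ B₁ hP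

/-- `¬ RootlessTop e X6P` for `e ≤ 6` (node 13's class needs `deg c₀ ≤ deg c₃ + e`, i.e. `e ≥ 7`). -/
theorem not_rootlessTop_X6P {e : ℕ} (he : e ≤ 6) : ¬ RootlessTop e X6P := by
  rintro ⟨k, c, hord, hroot, hP⟩
  by_cases hck : c k = 0
  · exact hroot 0 (by rw [hck, map_zero])
  obtain ⟨rfl, hc0, hc3⟩ := presentation_X6P hck hP
  have := hord 0 (by norm_num)
  rw [hc0, hc3, natDegree_X_pow_add_C, natDegree_one] at this
  omega

/-- **`¬ DecidedAt 2 X6P`** — each of the five disjuncts of the record's decided class refuted. -/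
theorem not_decidedAt_two_X6P : ¬ DecidedAt 2 X6P := by
  rintro (h | h | h | h | h)
  · have := seven_le_natDegree_X6P; omega
  · exact not_xLinearLt_X6P h
  · exact absurd h.1 (by norm_num)
  · have := three_le_thinThreshold X6P; omega
  · exact not_rootlessTop_X6P (by norm_num) h

/-- **`¬ LocalAt m₀ X6P` for `m₀ ≤ 2`** — node 14's slope condition FAILS on the far edge (`7 − 0 ≥ 3·m₀`). -/
theorem not_localAt_X6P {m₀ : ℕ} (hm : m₀ ≤ 2) : ¬ LocalAt m₀ X6P := by
  rintro ⟨k, c, hck, hP, -, hS⟩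
  obtain ⟨rfl, hc0, hc3⟩ := presentation_X6P hck hP
  have := hS 0 (by norm_num) (by rw [hc0, hc3, natDegree_X_pow_add_C, natDegree_one]; norm_num)
  rw [hc0, hc3, natDegree_X_pow_add_C, natDegree_one] at this
  omega

/-- `¬ LocalAt 2 X6P`. -/
theorem not_localAt_two_X6P : ¬ LocalAt 2 X6P := not_localAt_X6P le_rfl

/-- `X6` is NOT a Fermat trinomial of node 25 (FOUR monomials: `xCoeff X6P 0 = Y⁷ + 3`). -/
theorem not_fermatTri_X6P : ¬ FermatTri X6P := by
  have h : (xCoeff X6P 0).coeff 0 = 3 ∧ (xCoeff X6P 0).coeff 7 = 1 := by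
    rw [xCoeff_X6P, if_pos (Nat.zero_le _), xc_zero]; simp [coeff_X_pow]
  exact not_fermatTri_of_two_coeffs (by norm_num : (0 : ℕ) ≠ 7) (by rw [h.1]; norm_num) (by rw [h.2]; norm_num)

/-- `¬ DomSuper X6P` (node 24 refuses the middle term). -/
theorem not_domSuper_X6P : ¬ DomSuper X6P := fun h => by
  have h1 := h.2.1 1 le_rfl (by rw [xdeg_X6P]; norm_num)
  rw [xCoeff_X6P_one] at h1
  exact X_ne_zero h1

/-- `¬ DomHyper X6P` (node 23: `xdeg 3`). -/
theorem not_domHyper_X6P : ¬ DomHyper X6P := fun h => by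
  have := h.1; rw [xdeg_X6P] at this; omega

/-- **the territory summary of `X6`**: EMPTY at every level, `ThinFibreAt` at every `m₀`, and REFUSED BY NAME by every
hypothesis-free decider class of the record at `m₀ = 2` (nodes 13/14's `DecidedAt 2` / `LocalAt 2`, node 25's `FermatTri`,
node 24's `DomSuper`, node 23's `DomHyper`) — the E4 exhibit. -/
theorem X6P_territory :
    (∀ (N : ℕ) (r : ℚ), bev X6P (partialSum 2 N) r ≠ 0) ∧ (∀ m₀, ThinFibreAt m₀ X6P) ∧ LevelFinite X6P ∧
      ¬ DecidedAt 2 X6P ∧ ¬ LocalAt 2 X6P ∧ ¬ FermatTri X6P ∧ ¬ DomSuper X6P ∧ ¬ DomHyper X6P :=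
  ⟨no_level_X6P, thinFibreAt_X6P, levelFinite_X6P, not_decidedAt_two_X6P, not_localAt_two_X6P, not_fermatTri_X6P,
    not_domSuper_X6P, not_domHyper_X6P⟩

end Summit.Schanuel.Schanuel.Theorems.RootDecomp1KDigitPincer
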